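import Mathlib

/-!
# Route `SymPencil` — inner rank of the `2 | 2` row split of `per_4`, PEELED case: small TOOLS for
# the coverage assembly of the (8,8,11) two-pencil programme (`--supports`
# stmt-ValiantsHypothesis-5674 `SdcSuperquadratic`; (8,8) column; memo
# `NOTE-p8g15-5674-R2-two-pencil.md` §9.7; rung currency only)

Three bookkeeping lemmas used by `…TwoPencilCoverage.genSwap_of_frameless`:
* `dotProduct_mulVec_submatrix` — the bilinear form `a ⬝ Ψ x` in permuted coordinates;
* `form_of_single_entries` — the bilinear form of a `4 × 4` matrix whose columns `2, 3` vanish and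
  whose columns `0, 1` are single entries (rows `p`, `p'`): `a ⬝ Φ x = Φ_{p0} a_p x_0 + Φ_{p'1} a_{p'} x_1`;
* `caseA_of_witness` — the hypotheses of the Case-A class theorem
  `…TwoPencilCaseAParams.hframes_of_caseA_class` (three non-zero columns without swap pair) from
  three row witnesses, one per column, with for each pair of columns one witness off the other
  column's index.

Honest framing: bookkeeping only; no frame, chart or cell; the window `28 ≤ sdc(per₄) ≤ 29` of
record, the crux `SdcSuperquadratic` and `VP ≠ VNP` are untouched.  No definitions, no named
facts. [folklore]
-/

noncomputable section

-- single-conjunct layout: Sub = Summit, duplicated namespace component intended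
set_option linter.dupNamespace false

namespace Summit.ValiantsHypothesis.ValiantsHypothesis.Theorems.SymPencilPerFourPeeledTwoPencilCoverageTools

open Matrix Finset

universe u

variable {K : Type u} [Field K]

/-- The bilinear form of `Ψ` in permuted coordinates. [folklore] -/
theorem dotProduct_mulVec_submatrix (Ψ : Matrix (Fin 4) (Fin 4) K) (σ : Equiv.Perm (Fin 4))
    (a x : Fin 4 → K) : a ⬝ᵥ Ψ *ᵥ x = (a ∘ σ) ⬝ᵥ Ψ.submatrix σ σ *ᵥ (x ∘ σ) := by
  have e1 : a ⬝ᵥ Ψ *ᵥ x = ∑ i, a i * ∑ j, Ψ i j * x j := by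
    simp only [dotProduct, Matrix.mulVec]
  have e2 : (a ∘ σ) ⬝ᵥ Ψ.submatrix σ σ *ᵥ (x ∘ σ) =
      ∑ i, a (σ i) * ∑ j, Ψ (σ i) (σ j) * x (σ j) := by
    simp only [dotProduct, Matrix.mulVec, Matrix.submatrix_apply, Function.comp_apply]
  rw [e1, e2, Equiv.sum_comp σ (fun i => a i * ∑ j, Ψ i (σ j) * x (σ j))]
  refine Finset.sum_congr rfl fun i _ => ?_
  rw [Equiv.sum_comp σ (fun j => Ψ i j * x j)]

/-- The bilinear form of a matrix with columns `2, 3` zero and single-entry columns `0, 1`.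
[folklore] -/
theorem form_of_single_entries (Φ : Matrix (Fin 4) (Fin 4) K) (p p' : Fin 4)
    (f2 : ∀ i, Φ i 2 = 0) (f3 : ∀ i, Φ i 3 = 0)
    (m0 : ∀ q, q ≠ p → Φ q 0 = 0) (m1 : ∀ q, q ≠ p' → Φ q 1 = 0) :
    ∀ a x : Fin 4 → K, a ⬝ᵥ Φ *ᵥ x = Φ p 0 * a p * x 0 + Φ p' 1 * a p' * x 1 := by
  intro a x
  have hrow : ∀ i, (Φ *ᵥ x) i = Φ i 0 * x 0 + Φ i 1 * x 1 := fun i => by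
    simp only [Matrix.mulVec, dotProduct, Fin.sum_univ_four, f2 i, f3 i]
    ring
  have s0 : ∑ i, a i * (Φ i 0 * x 0) = Φ p 0 * a p * x 0 := by
    rw [Finset.sum_eq_single p]
    · ring
    · intro q _ hq; rw [m0 q hq]; ring
    · intro h; exact absurd (Finset.mem_univ p) h
  have s1 : ∑ i, a i * (Φ i 1 * x 1) = Φ p' 1 * a p' * x 1 := by
    rw [Finset.sum_eq_single p']
    · ring
    · intro q _ hq; rw [m1 q hq]; ring
    · intro h; exact absurd (Finset.mem_univ p') h
  calc a ⬝ᵥ Φ *ᵥ x = ∑ i, a i * (Φ i 0 * x 0 + Φ i 1 * x 1) := by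
        simp only [dotProduct, hrow]
    _ = ∑ i, a i * (Φ i 0 * x 0) + ∑ i, a i * (Φ i 1 * x 1) := by
        rw [← Finset.sum_add_distrib]; exact Finset.sum_congr rfl fun i _ => by ring
    _ = _ := by rw [s0, s1]

/-- **Case-A hypotheses from witnesses**: the three columns `σ0, σ1, σ2` of `M` are non-zero at the
rows `w₀, w₁, w₂`, and for each pair one witness lies off the other column's index — then the
columns are non-zero with no swap pair (hypotheses of `hframes_of_caseA_class`). [folklore] -/
theorem caseA_of_witness (M : Matrix (Fin 4) (Fin 4) K) (σ : Equiv.Perm (Fin 4))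
    (w₀ w₁ w₂ : Fin 4) (h0 : M w₀ (σ 0) ≠ 0) (h1 : M w₁ (σ 1) ≠ 0) (h2 : M w₂ (σ 2) ≠ 0)
    (h01 : w₀ ≠ σ 1 ∨ w₁ ≠ σ 0) (h02 : w₀ ≠ σ 2 ∨ w₂ ≠ σ 0) (h12 : w₁ ≠ σ 2 ∨ w₂ ≠ σ 1) :
    (∀ j : Fin 4, j ≠ 3 → ∃ i, M i (σ j) ≠ 0) ∧
      (∀ j j' : Fin 4, j ≠ 3 → j' ≠ 3 → j ≠ j' →
        ¬ ((∀ i, i ≠ σ j' → M i (σ j) = 0) ∧ (∀ i, i ≠ σ j → M i (σ j') = 0) ∧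
            M (σ j') (σ j) = M (σ j) (σ j'))) := by
  have four : ∀ j : Fin 4, j = 0 ∨ j = 1 ∨ j = 2 ∨ j = 3 := by decide
  refine ⟨?_, ?_⟩
  · intro j hj
    rcases four j with rfl | rfl | rfl | rfl
    · exact ⟨w₀, h0⟩
    · exact ⟨w₁, h1⟩
    · exact ⟨w₂, h2⟩
    · exact absurd rfl hj
  · rintro j j' hj hj' hjj' ⟨S1, S2, -⟩
    rcases four j with rfl | rfl | rfl | rfl <;> rcases four j' with rfl | rfl | rfl | rfl
    all_goals first
      | exact absurd rfl hjj'
      | exact absurd rfl hj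
      | exact absurd rfl hj'
      | (rcases h01 with h | h
         · first | exact h0 (S1 w₀ h) | exact h0 (S2 w₀ h)
         · first | exact h1 (S2 w₁ h) | exact h1 (S1 w₁ h))
      | (rcases h02 with h | h
         · first | exact h0 (S1 w₀ h) | exact h0 (S2 w₀ h)
         · first | exact h2 (S2 w₂ h) | exact h2 (S1 w₂ h))
      | (rcases h12 with h | h
         · first | exact h1 (S1 w₁ h) | exact h1 (S2 w₁ h)
         · first | exact h2 (S2 w₂ h) | exact h2 (S1 w₂ h))

end Summit.ValiantsHypothesis.ValiantsHypothesis.Theorems.SymPencilPerFourPeeledTwoPencilCoverageTools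

end
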